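import Summits.BirchSwinnertonDyer.Rank2Observatory.ZywinaFamilyPoints
import HarnessLib

/-!
# Zywina's family, file 2 of 4: `2P₁` and `2P₂` reduce non-singularly at every prime

See `ZywinaFamilyPoints` for the statement of THEOREM R* (cell bsd-rank2) and the plan. Here:
§Coprime (numerators and denominators of `x(2P₁) = (m+28n²)²/(4n)²`,
`x(2P₂) = (m²+41mn²+76n⁴)²/(6n(m-2n²))²`, `x(2(P₁+P₂)) = (m+13n²)²/(2n)²` are coprime) and
§Reduction: for `Q ∈ {2P₁, 2P₂}` and EVERY prime `ℓ`, `HasNonsingularReductionAt ℓ x(Q) y(Q)` —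
denominator primes by `‖x‖_ℓ > 1` (`hasNonsingularReductionAt_of_one_lt_norm`), the bad primes
`ℓ ∈ {m, q, r}` by the unit test `‖y‖_ℓ = 1` (`(y d³)² = N ≡ c · n^k (mod ℓ)` with
`{2,3,7,19}`-smooth `c ≠ 0` and `ℓ ∤ n`), all other primes by `ℓ ∤ Δ = 2⁸ 3² m q³ r²`
(`hasNonsingularReductionAt_of_norm_Δ_eq_one`). B1 honesty: height algebra on a rank-2 family;
nothing here reads the analytic rank.
-/

noncomputable section

open scoped Classical
open Literature.NumberTheory.EllipticCurves Literature.NumberTheory.EllipticCurves.Zywina2025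
open WeierstrassCurve

namespace Summit.BirchSwinnertonDyer.Rank2Observatory.ZywinaFamily

/-! ### Coprimality of numerators and denominators of the doubles -/

section Coprime

variable {m n : ℕ}

/-- `gcd(m + 28n², 4n) = 1`. -/
theorem coprime_α₁ (h : ZywinaAdmissible m n) : Nat.Coprime (m + 28 * n ^ 2) (4 * n) := by
  refine Nat.coprime_of_dvd fun k hk hkα hkd => ?_
  rcases (Nat.Prime.dvd_mul hk).mp hkd with hk4 | hkn
  · have hk2 : k = 2 := (Nat.prime_dvd_prime_iff_eq hk Nat.prime_two).mp
      (Nat.Prime.dvd_of_dvd_pow hk (by simpa using hk4 : k ∣ 2 ^ 2))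
    subst hk2
    have := (adm_m_mod h)
    have h2n : 2 ∣ 28 * n ^ 2 := dvd_mul_of_dvd_left (by norm_num) _
    have := (Nat.dvd_add_right h2n).mp (by simpa [add_comm] using hkα)
    omega
  · have hkm : k ∣ m := by
      have h1 : k ∣ 28 * n ^ 2 := dvd_mul_of_dvd_right (dvd_pow hkn two_ne_zero) _
      exact (Nat.dvd_add_left h1).mp hkα
    have := (Nat.prime_dvd_prime_iff_eq hk (adm_m_prime h)).mp hkm
    subst this
    exact (adm_not_m_dvd_n h) hkn

/-- `gcd(m + 13n², 2n) = 1`. -/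
theorem coprime_α₃ (h : ZywinaAdmissible m n) : Nat.Coprime (m + 13 * n ^ 2) (2 * n) := by
  refine Nat.coprime_of_dvd fun k hk hkα hkd => ?_
  rcases (Nat.Prime.dvd_mul hk).mp hkd with hk2 | hkn
  · have hk2 : k = 2 := (Nat.prime_dvd_prime_iff_eq hk Nat.prime_two).mp hk2
    subst hk2
    have := (adm_m_mod h)
    obtain ⟨c, hc⟩ := (adm_two_dvd_n h)
    subst hc
    have h2n : 2 ∣ 13 * (2 * c) ^ 2 := ⟨26 * c ^ 2, by ring⟩
    have := (Nat.dvd_add_left h2n).mp hkα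
    omega
  · have hkm : k ∣ m := by
      have h1 : k ∣ 13 * n ^ 2 := dvd_mul_of_dvd_right (dvd_pow hkn two_ne_zero) _
      exact (Nat.dvd_add_left h1).mp hkα
    have := (Nat.prime_dvd_prime_iff_eq hk (adm_m_prime h)).mp hkm
    subst this
    exact (adm_not_m_dvd_n h) hkn

/-- `(|m - 2n²| : ℚ)² = (m - 2n²)²`. -/
theorem cast_tAbs_sq (m n : ℕ) :
    ((((m : ℤ) - 2 * (n : ℤ) ^ 2).natAbs : ℚ)) ^ 2 = ((m : ℚ) - 2 * (n : ℚ) ^ 2) ^ 2 := by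
  simp only [Nat.cast_natAbs, Int.cast_abs, sq_abs]; push_cast; ring

/-- `m ≠ 2n²` (indeed `m` is odd). -/
theorem tAbs_pos (h : ZywinaAdmissible m n) : 0 < ((m : ℤ) - 2 * (n : ℤ) ^ 2).natAbs := by
  rw [Int.natAbs_pos]
  intro h0
  obtain ⟨k, hk⟩ : ∃ k : ℤ, (n : ℤ) ^ 2 = k := ⟨_, rfl⟩
  rw [hk] at h0
  have := (adm_m_mod h)
  omega

/-- `(6n(m - 2n²))² = (6n|m - 2n²|)²` in `ℚ`. -/
theorem den₂_sq_eq (m n : ℕ) :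
    (6 * (n : ℚ) * ((m : ℚ) - 2 * (n : ℚ) ^ 2)) ^ 2 =
      (((6 * n * ((m : ℤ) - 2 * (n : ℤ) ^ 2).natAbs : ℕ) : ℚ)) ^ 2 := by
  simp only [Nat.cast_mul, mul_pow]
  rw [cast_tAbs_sq]
  push_cast
  ring

/-- `gcd(m² + 41mn² + 76n⁴, 6n|m - 2n²|) = 1`. -/
theorem coprime_α₂ (h : ZywinaAdmissible m n) :
    Nat.Coprime (m ^ 2 + 41 * m * n ^ 2 + 76 * n ^ 4) (6 * n * ((m : ℤ) - 2 * (n : ℤ) ^ 2).natAbs) := by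
  refine Nat.coprime_of_dvd fun k hk hkα hkd => ?_
  haveI : Fact k.Prime := ⟨hk⟩
  -- work modulo `k`
  have hα0 : ((m ^ 2 + 41 * m * n ^ 2 + 76 * n ^ 4 : ℕ) : ZMod k) = 0 :=
    (ZMod.natCast_eq_zero_iff _ k).mpr hkα
  push_cast at hα0
  -- case `k ∣ n` (covers `k = 3`)
  by_cases hkn : k ∣ n
  · have hn0 : (n : ZMod k) = 0 := (ZMod.natCast_eq_zero_iff n k).mpr hkn
    rw [hn0] at hα0
    have hm0 : (m : ZMod k) = 0 := by simpa using hα0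
    have hkm : k ∣ m := (ZMod.natCast_eq_zero_iff m k).mp hm0
    have := (Nat.prime_dvd_prime_iff_eq hk (adm_m_prime h)).mp hkm
    subst this
    exact (adm_not_m_dvd_n h) hkn
  -- case `k = 2`: `α₂` is odd
  by_cases hk2 : k = 2
  · subst hk2
    exact hkn (adm_two_dvd_n h)
  -- remaining: `k ∣ 6 n t`, `k ∤ n`, `k ≠ 2`; so `k = 3` (then `k ∣ n`, excluded) or `k ∣ t`
  have hk3 : k ≠ 3 := by rintro rfl; exact hkn (adm_three_dvd_n h)
  have hkt : k ∣ ((m : ℤ) - 2 * (n : ℤ) ^ 2).natAbs := by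
    rcases (Nat.Prime.dvd_mul hk).mp hkd with h6n | ht
    · rcases (Nat.Prime.dvd_mul hk).mp h6n with h6 | hn'
      · exfalso
        have : k ≤ 6 := Nat.le_of_dvd (by norm_num) h6
        interval_cases k <;> simp_all (config := {decide := true})
      · exact absurd hn' hkn
    · exact ht
  have hm2 : (m : ZMod k) = 2 * (n : ZMod k) ^ 2 := by
    have : (((m : ℤ) - 2 * (n : ℤ) ^ 2 : ℤ) : ZMod k) = 0 := by
      rw [ZMod.intCast_zmod_eq_zero_iff_dvd]
      exact Int.natCast_dvd.mpr (by simpa using hkt)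
    push_cast at this
    linear_combination this
  rw [hm2] at hα0
  have h162 : (162 : ZMod k) * (n : ZMod k) ^ 4 = 0 := by linear_combination hα0
  rcases mul_eq_zero.mp h162 with h0 | h0
  · have : ((2 : ℕ) : ZMod k) ^ 1 * ((3 : ℕ) : ZMod k) ^ 4 = 0 := by
      rw [← h0]; push_cast; norm_num
    rcases mul_eq_zero.mp this with h2 | h3
    · exact natCast_zmod_ne_zero_of_prime_ne Nat.prime_two hk2 (pow_eq_zero_iff one_ne_zero |>.mp h2)
    · exact natCast_zmod_ne_zero_of_prime_ne Nat.prime_three hk3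
        ((pow_eq_zero_iff (by norm_num)).mp h3)
  · exact natCast_zmod_ne_zero_of_not_dvd hkn ((pow_eq_zero_iff (by norm_num)).mp h0)

end Coprime

/-! ### Non-singular reduction of `2P₁` and `2P₂` at every prime -/

section Reduction

variable {m n : ℕ}


/-- For a point `(α²/d², y')` of `E_{m,n}`: `(y' d³)² = N`. -/
theorem sq_eq_Nval {α d : ℤ} {y' : ℚ} (hd : (d : ℚ) ≠ 0)
    (h' : (zywinaCurve m n).toAffine.Nonsingular (((α : ℚ) ^ 2 / (d : ℚ) ^ 2)) y') :
    (y' * (d : ℚ) ^ 3) ^ 2 = ((α ^ 6 - 5 * (m + 16 * n ^ 2 : ℕ) * α ^ 4 * d ^ 2 +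
      4 * (m + 16 * n ^ 2 : ℕ) * (m + 25 * n ^ 2 : ℕ) * α ^ 2 * d ^ 4 : ℤ) : ℚ) := by
  have e := (WeierstrassCurve.Affine.equation_iff _ _).mp h'.1
  simp only [zywinaCurve] at e
  have e' : y' ^ 2 = ((α : ℚ) ^ 2 / (d : ℚ) ^ 2) ^ 3 + (-5 * ((m : ℚ) + 16 * (n : ℚ) ^ 2)) *
      ((α : ℚ) ^ 2 / (d : ℚ) ^ 2) ^ 2 + (4 * ((m : ℚ) + 16 * (n : ℚ) ^ 2) *
        ((m : ℚ) + 25 * (n : ℚ) ^ 2)) * ((α : ℚ) ^ 2 / (d : ℚ) ^ 2) := by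
    linear_combination e
  rw [sq_mul_cube_eq hd e' rfl]
  push_cast
  ring

/-- **Unit test at a bad prime**: if `d` and `N` are `ℓ`-adic units then `‖y'‖_ℓ = 1`, so the point
reduces non-singularly modulo `ℓ` (`Φ_y = 2y'`). -/
theorem hasNonsingularReductionAt_of_Nval {ℓ : ℕ} [Fact ℓ.Prime] (hℓ2 : ℓ ≠ 2) {α d : ℤ} {y' : ℚ}
    (h' : (zywinaCurve m n).toAffine.Nonsingular (((α : ℚ) ^ 2 / (d : ℚ) ^ 2)) y')
    (hd : (d : ZMod ℓ) ≠ 0)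
    (hN : ((α ^ 6 - 5 * (m + 16 * n ^ 2 : ℕ) * α ^ 4 * d ^ 2 +
      4 * (m + 16 * n ^ 2 : ℕ) * (m + 25 * n ^ 2 : ℕ) * α ^ 2 * d ^ 4 : ℤ) : ZMod ℓ) ≠ 0) :
    (zywinaCurve m n).HasNonsingularReductionAt ℓ ((α : ℚ) ^ 2 / (d : ℚ) ^ 2) y' := by
  haveI := isCharNeTwoNF_zywinaCurve m n
  haveI := isIntegral_zywinaCurve m n
  have hd1 : ‖((d : ℚ) : ℚ_[ℓ])‖ = 1 := by
    rw [Rat.cast_intCast]; exact norm_intCast_eq_one_of_zmod_ne_zero hd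
  have hd0 : (d : ℚ) ≠ 0 := by
    intro h0; rw [h0, Rat.cast_zero, norm_zero] at hd1; exact zero_ne_one hd1
  have hsq := congrArg (fun t : ℚ => (t : ℚ_[ℓ])) (sq_eq_Nval hd0 h')
  push_cast at hsq hd1
  have hN1 := norm_intCast_eq_one_of_zmod_ne_zero hN
  refine hasNonsingularReductionAt_of_norm_y_eq_one hℓ2 (norm_eq_one_of_sq hsq hd1 ?_)
  push_cast at hN1 ⊢
  exact hN1

/-- `m, q, r` as elements of `ZMod` of each other, and `n ≠ 0` there. -/
private theorem zmod_facts (h : ZywinaAdmissible m n) :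
    ((m : ZMod m) = 0 ∧ (n : ZMod m) ≠ 0) ∧
    ((m : ZMod (m + 16 * n ^ 2)) = -16 * (n : ZMod (m + 16 * n ^ 2)) ^ 2 ∧
      (n : ZMod (m + 16 * n ^ 2)) ≠ 0) ∧
    ((m : ZMod (m + 25 * n ^ 2)) = -25 * (n : ZMod (m + 25 * n ^ 2)) ^ 2 ∧
      (n : ZMod (m + 25 * n ^ 2)) ≠ 0) := by
  refine ⟨⟨ZMod.natCast_self m, ?_⟩, ⟨?_, ?_⟩, ⟨?_, ?_⟩⟩
  · rw [Ne, ZMod.natCast_eq_zero_iff]; exact (adm_not_m_dvd_n h)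
  · have := ZMod.natCast_self (m + 16 * n ^ 2); push_cast at this; linear_combination this
  · rw [Ne, ZMod.natCast_eq_zero_iff]; exact (adm_not_q_dvd_n h)
  · have := ZMod.natCast_self (m + 25 * n ^ 2); push_cast at this; linear_combination this
  · rw [Ne, ZMod.natCast_eq_zero_iff]; exact (adm_not_r_dvd_n h)

/-- Small primes are non-zero modulo a prime `≡ 11 (mod 24)`. -/
private theorem small_ne_zero {ℓ : ℕ} [Fact ℓ.Prime] (h24 : ℓ % 24 = 11) :
    (2 : ZMod ℓ) ≠ 0 ∧ (3 : ZMod ℓ) ≠ 0 ∧ (7 : ZMod ℓ) ≠ 0 ∧ (19 : ZMod ℓ) ≠ 0 := by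
  have h2 := natCast_zmod_ne_zero_of_prime_ne (ℓ := ℓ) Nat.prime_two (by omega)
  have h3 := natCast_zmod_ne_zero_of_prime_ne (ℓ := ℓ) Nat.prime_three (by omega)
  have h7 := natCast_zmod_ne_zero_of_prime_ne (ℓ := ℓ) (show (7 : ℕ).Prime by norm_num) (by omega)
  have h19 := natCast_zmod_ne_zero_of_prime_ne (ℓ := ℓ) (show (19 : ℕ).Prime by norm_num) (by omega)
  push_cast at h2 h3 h7 h19
  exact ⟨h2, h3, h7, h19⟩

/-- **`2P₁` reduces non-singularly at every prime.** -/
theorem hasNonsingularReductionAt_two_nsmul_P₁ (h : ZywinaAdmissible m n) {y' : ℚ}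
    (h' : (zywinaCurve m n).toAffine.Nonsingular
      ((((m + 28 * n ^ 2 : ℕ) : ℚ) ^ 2) / (((4 * n : ℕ) : ℚ) ^ 2)) y')
    {ℓ : ℕ} (hℓ : ℓ.Prime) :
    (zywinaCurve m n).HasNonsingularReductionAt ℓ
      ((((m + 28 * n ^ 2 : ℕ) : ℚ) ^ 2) / (((4 * n : ℕ) : ℚ) ^ 2)) y' := by
  haveI := isCharNeTwoNF_zywinaCurve m n
  haveI := isIntegral_zywinaCurve m n
  haveI : Fact ℓ.Prime := ⟨hℓ⟩
  obtain ⟨⟨hmm, hnm⟩, ⟨hmq, hnq⟩, ⟨hmr, hnr⟩⟩ := zmod_facts h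
  -- primes dividing the denominator
  by_cases hℓd : ℓ ∣ 4 * n
  · exact hasNonsingularReductionAt_of_one_lt_norm y'
      (one_lt_norm_sq_div_sq (coprime_α₁ h) (by have := (adm_n_pos h); omega) hℓd)
  have hℓ2 : ℓ ≠ 2 := by rintro rfl; exact hℓd (dvd_mul_right 2 (2 * n) |>.trans ⟨1, by ring⟩)
  have hℓn : ¬ ℓ ∣ n := fun hn => hℓd (dvd_mul_of_dvd_right hn 4)
  have hℓ3 : ℓ ≠ 3 := by rintro rfl; exact hℓn (adm_three_dvd_n h)
  have hnℓ : (n : ZMod ℓ) ≠ 0 := natCast_zmod_ne_zero_of_not_dvd hℓn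
  -- rewrite the point's `x` with integer casts
  have hx : ((((m + 28 * n ^ 2 : ℕ) : ℚ) ^ 2) / (((4 * n : ℕ) : ℚ) ^ 2)) =
      (((m + 28 * n ^ 2 : ℤ) : ℚ) ^ 2 / ((4 * n : ℤ) : ℚ) ^ 2) := by push_cast; ring
  rw [hx] at h' ⊢
  have hd : ((4 * n : ℤ) : ZMod ℓ) ≠ 0 := by
    push_cast
    refine mul_ne_zero ?_ hnℓ
    have := natCast_zmod_ne_zero_of_prime_ne (ℓ := ℓ) Nat.prime_two hℓ2
    rw [show (4 : ZMod ℓ) = (2 : ℕ) * (2 : ℕ) by push_cast; norm_num]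
    exact mul_ne_zero this this
  -- the three bad primes
  by_cases hℓm : ℓ = m
  · subst hℓm
    obtain ⟨h2, h3, h7, -⟩ := small_ne_zero (ℓ := ℓ) (adm_m_mod h)
    refine hasNonsingularReductionAt_of_Nval hℓ2 h' hd fun h0 => ?_
    push_cast at h0
    rw [hmm] at h0
    have key : (2 ^ 12 * 3 ^ 4 * 7 ^ 2 * (n : ZMod ℓ) ^ 12) = 0 := by
      linear_combination h0
    exact mul_ne_zero (mul_ne_zero (mul_ne_zero (pow_ne_zero _ h2) (pow_ne_zero _ h3))
      (pow_ne_zero _ h7)) (pow_ne_zero _ hnm) key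
  by_cases hℓq : ℓ = m + 16 * n ^ 2
  · subst hℓq
    obtain ⟨h2, h3, -, -⟩ := small_ne_zero (ℓ := m + 16 * n ^ 2) (adm_q_mod h)
    refine hasNonsingularReductionAt_of_Nval hℓ2 h' hd fun h0 => ?_
    push_cast at h0
    rw [hmq] at h0
    have key : (2 ^ 12 * 3 ^ 6 * (n : ZMod (m + 16 * n ^ 2)) ^ 12) = 0 := by
      linear_combination h0
    exact mul_ne_zero (mul_ne_zero (pow_ne_zero _ h2) (pow_ne_zero _ h3)) (pow_ne_zero _ hnq) key
  by_cases hℓr : ℓ = m + 25 * n ^ 2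
  · subst hℓr
    obtain ⟨-, h3, -, -⟩ := small_ne_zero (ℓ := m + 25 * n ^ 2) (adm_r_mod h)
    refine hasNonsingularReductionAt_of_Nval hℓ2 h' hd fun h0 => ?_
    push_cast at h0
    rw [hmr] at h0
    have key : (3 ^ 10 * (n : ZMod (m + 25 * n ^ 2)) ^ 12) = 0 := by
      linear_combination h0
    exact mul_ne_zero (pow_ne_zero _ h3) (pow_ne_zero _ hnr) key
  -- good primes: `ℓ ∤ Δ = 2⁸ 3² m q³ r²`
  refine hasNonsingularReductionAt_of_norm_Δ_eq_one rfl hℓ2 ?_ h'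
  have hΔ : ((zywinaCurve m n).Δ : ℚ) =
      ((2 ^ 8 * 3 ^ 2 * m * (m + 16 * n ^ 2) ^ 3 * (m + 25 * n ^ 2) ^ 2 : ℤ) : ℚ) := by
    rw [(zywinaCurve m n).Δ_of_isCharNeTwoNF]; simp only [zywinaCurve]; push_cast; ring
  rw [hΔ, Rat.cast_intCast]
  refine norm_intCast_eq_one_of_zmod_ne_zero ?_
  have h2 := natCast_zmod_ne_zero_of_prime_ne (ℓ := ℓ) Nat.prime_two hℓ2
  have h3 := natCast_zmod_ne_zero_of_prime_ne (ℓ := ℓ) Nat.prime_three hℓ3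
  have hm' := natCast_zmod_ne_zero_of_prime_ne (ℓ := ℓ) (adm_m_prime h) hℓm
  have hq' := natCast_zmod_ne_zero_of_prime_ne (ℓ := ℓ) (adm_q_prime h) hℓq
  have hr' := natCast_zmod_ne_zero_of_prime_ne (ℓ := ℓ) (adm_r_prime h) hℓr
  push_cast at h2 h3 hm' hq' hr' ⊢
  have h2304 : (2304 : ZMod ℓ) ≠ 0 := by
    rw [show (2304 : ZMod ℓ) = 2 ^ 8 * 3 ^ 2 by norm_num]
    exact mul_ne_zero (pow_ne_zero _ h2) (pow_ne_zero _ h3)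
  exact mul_ne_zero (mul_ne_zero (mul_ne_zero h2304 hm') (pow_ne_zero _ hq')) (pow_ne_zero _ hr')

end Reduction

section Reduction2

variable {m n : ℕ}

/-- **`2P₂` reduces non-singularly at every prime.** -/
theorem hasNonsingularReductionAt_two_nsmul_P₂ (h : ZywinaAdmissible m n) {y' : ℚ}
    (h' : (zywinaCurve m n).toAffine.Nonsingular
      ((((m ^ 2 + 41 * m * n ^ 2 + 76 * n ^ 4 : ℕ) : ℚ) ^ 2) /
        ((6 * (n : ℚ) * ((m : ℚ) - 2 * (n : ℚ) ^ 2)) ^ 2)) y')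
    {ℓ : ℕ} (hℓ : ℓ.Prime) :
    (zywinaCurve m n).HasNonsingularReductionAt ℓ
      ((((m ^ 2 + 41 * m * n ^ 2 + 76 * n ^ 4 : ℕ) : ℚ) ^ 2) /
        ((6 * (n : ℚ) * ((m : ℚ) - 2 * (n : ℚ) ^ 2)) ^ 2)) y' := by
  haveI := isCharNeTwoNF_zywinaCurve m n
  haveI := isIntegral_zywinaCurve m n
  haveI : Fact ℓ.Prime := ⟨hℓ⟩
  obtain ⟨⟨hmm, hnm⟩, ⟨hmq, hnq⟩, ⟨hmr, hnr⟩⟩ := zmod_facts h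
  -- primes dividing the denominator `6 n |m - 2n²|`
  have hxN : ((((m ^ 2 + 41 * m * n ^ 2 + 76 * n ^ 4 : ℕ) : ℚ) ^ 2) /
        ((6 * (n : ℚ) * ((m : ℚ) - 2 * (n : ℚ) ^ 2)) ^ 2)) =
      (((m ^ 2 + 41 * m * n ^ 2 + 76 * n ^ 4 : ℕ) : ℚ) ^ 2 /
        (((6 * n * ((m : ℤ) - 2 * (n : ℤ) ^ 2).natAbs : ℕ) : ℚ) ^ 2)) := by
    rw [den₂_sq_eq]
  by_cases hℓd : ℓ ∣ 6 * n * ((m : ℤ) - 2 * (n : ℤ) ^ 2).natAbs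
  · rw [hxN]
    exact hasNonsingularReductionAt_of_one_lt_norm y'
      (one_lt_norm_sq_div_sq (coprime_α₂ h) (by have := (adm_n_pos h); have := tAbs_pos h; positivity) hℓd)
  have hℓ6 : ¬ ℓ ∣ 6 := fun h6 => hℓd (dvd_mul_of_dvd_left (dvd_mul_of_dvd_left h6 n) _)
  have hℓn : ¬ ℓ ∣ n := fun hn => hℓd (dvd_mul_of_dvd_left (dvd_mul_of_dvd_right hn 6) _)
  have hℓt : ¬ ℓ ∣ ((m : ℤ) - 2 * (n : ℤ) ^ 2).natAbs := fun ht => hℓd (dvd_mul_of_dvd_right ht _)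
  have hℓ2 : ℓ ≠ 2 := by rintro rfl; exact hℓ6 (by norm_num)
  have hℓ3 : ℓ ≠ 3 := by rintro rfl; exact hℓ6 (by norm_num)
  have hnℓ : (n : ZMod ℓ) ≠ 0 := natCast_zmod_ne_zero_of_not_dvd hℓn
  have h2ℓ := natCast_zmod_ne_zero_of_prime_ne (ℓ := ℓ) Nat.prime_two hℓ2
  have h3ℓ := natCast_zmod_ne_zero_of_prime_ne (ℓ := ℓ) Nat.prime_three hℓ3
  push_cast at h2ℓ h3ℓ
  -- rewrite the point's `x` with integer casts
  have hx : ((((m ^ 2 + 41 * m * n ^ 2 + 76 * n ^ 4 : ℕ) : ℚ) ^ 2) /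
        ((6 * (n : ℚ) * ((m : ℚ) - 2 * (n : ℚ) ^ 2)) ^ 2)) =
      (((m ^ 2 + 41 * m * n ^ 2 + 76 * n ^ 4 : ℤ) : ℚ) ^ 2 /
        ((6 * n * ((m : ℤ) - 2 * (n : ℤ) ^ 2) : ℤ) : ℚ) ^ 2) := by push_cast; ring
  rw [hx] at h' ⊢
  have htℓ : (((m : ℤ) - 2 * (n : ℤ) ^ 2 : ℤ) : ZMod ℓ) ≠ 0 := by
    rw [Ne, ZMod.intCast_zmod_eq_zero_iff_dvd]
    intro hdvd
    apply hℓt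
    exact Int.natCast_dvd.mp (by simpa using hdvd)
  have hd : ((6 * n * ((m : ℤ) - 2 * (n : ℤ) ^ 2) : ℤ) : ZMod ℓ) ≠ 0 := by
    push_cast at htℓ ⊢
    refine mul_ne_zero (mul_ne_zero ?_ hnℓ) htℓ
    rw [show (6 : ZMod ℓ) = 2 * 3 by norm_num]
    exact mul_ne_zero h2ℓ h3ℓ
  -- the three bad primes
  by_cases hℓm : ℓ = m
  · subst hℓm
    obtain ⟨h2, -, -, h19⟩ := small_ne_zero (ℓ := ℓ) (adm_m_mod h)
    refine hasNonsingularReductionAt_of_Nval hℓ2 h' hd fun h0 => ?_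
    push_cast at h0
    rw [hmm] at h0
    have key : (2 ^ 12 * 19 ^ 2 * (n : ZMod ℓ) ^ 24) = 0 := by
      linear_combination h0
    exact mul_ne_zero (mul_ne_zero (pow_ne_zero _ h2) (pow_ne_zero _ h19)) (pow_ne_zero _ hnm) key
  by_cases hℓq : ℓ = m + 16 * n ^ 2
  · subst hℓq
    refine hasNonsingularReductionAt_of_Nval hℓ2 h' hd fun h0 => ?_
    push_cast at h0
    rw [hmq] at h0
    have key : (2 ^ 12 * 3 ^ 24 * (n : ZMod (m + 16 * n ^ 2)) ^ 24) = 0 := by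
      linear_combination h0
    exact mul_ne_zero (mul_ne_zero (pow_ne_zero _ h2ℓ) (pow_ne_zero _ h3ℓ)) (pow_ne_zero _ hnq) key
  by_cases hℓr : ℓ = m + 25 * n ^ 2
  · subst hℓr
    obtain ⟨-, -, h7, -⟩ := small_ne_zero (ℓ := m + 25 * n ^ 2) (adm_r_mod h)
    refine hasNonsingularReductionAt_of_Nval hℓ2 h' hd fun h0 => ?_
    push_cast at h0
    rw [hmr] at h0
    have key : (2 ^ 10 * 3 ^ 24 * 7 ^ 2 * (n : ZMod (m + 25 * n ^ 2)) ^ 24) = 0 := by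
      linear_combination h0
    exact mul_ne_zero (mul_ne_zero (mul_ne_zero (pow_ne_zero _ h2ℓ) (pow_ne_zero _ h3ℓ))
      (pow_ne_zero _ h7)) (pow_ne_zero _ hnr) key
  -- good primes
  refine hasNonsingularReductionAt_of_norm_Δ_eq_one rfl hℓ2 ?_ h'
  have hΔ : ((zywinaCurve m n).Δ : ℚ) =
      ((2 ^ 8 * 3 ^ 2 * m * (m + 16 * n ^ 2) ^ 3 * (m + 25 * n ^ 2) ^ 2 : ℤ) : ℚ) := by
    rw [(zywinaCurve m n).Δ_of_isCharNeTwoNF]; simp only [zywinaCurve]; push_cast; ring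
  rw [hΔ, Rat.cast_intCast]
  refine norm_intCast_eq_one_of_zmod_ne_zero ?_
  have hm' := natCast_zmod_ne_zero_of_prime_ne (ℓ := ℓ) (adm_m_prime h) hℓm
  have hq' := natCast_zmod_ne_zero_of_prime_ne (ℓ := ℓ) (adm_q_prime h) hℓq
  have hr' := natCast_zmod_ne_zero_of_prime_ne (ℓ := ℓ) (adm_r_prime h) hℓr
  push_cast at hm' hq' hr' ⊢
  have h2304 : (2304 : ZMod ℓ) ≠ 0 := by
    rw [show (2304 : ZMod ℓ) = 2 ^ 8 * 3 ^ 2 by norm_num]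
    exact mul_ne_zero (pow_ne_zero _ h2ℓ) (pow_ne_zero _ h3ℓ)
  exact mul_ne_zero (mul_ne_zero (mul_ne_zero h2304 hm') (pow_ne_zero _ hq')) (pow_ne_zero _ hr')

end Reduction2
end Summit.BirchSwinnertonDyer.Rank2Observatory.ZywinaFamily
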